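import Mathlib.LinearAlgebra.Matrix.Permanent
import Mathlib.RingTheory.MvPolynomial.Basic
import Mathlib.Data.Nat.Choose.Sum
import Mathlib.Data.Fintype.BigOperators
import Mathlib.Tactic
import Literature.Computability.AlgebraicComplexity.StandardFamilies
import HarnessLib

/-!
# Ryser's formula for the permanent

**What is proved** (`permanent_eq_ryser`). Over a commutative ring, for a square matrix `A` indexed
by a finite type `ι` with `n = |ι|`:
`per A = Σ_{S ⊆ ι} (-1)^(n - |S|) · ∏_i Σ_{j ∈ S} A i j` (Ryser 1963). Proof by inclusion–exclusion:
expanding the products turns the right-hand side into `Σ_{f : ι → ι} ∏_i A i (f i) · Σ_{S ⊇ im f}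
(-1)^(n-|S|)`, and the inner alternating sum over the supersets of `im f` (`= Σ_{T ⊆ (im f)ᶜ} (-1)^|T|`,
`Finset.sum_powerset_neg_one_pow_card`) is `1` if `f` is onto and `0` otherwise. Consequences for
the generic permanent: `perPoly_eq_ryser`, and `exists_rowLocal_repr_perPoly` — `per_n` is a sum of
`2^n` products of ROW-LOCAL linear forms (a row-set-multilinear `ΣΠΣ` expression of top fan-in
`2^n`), the upper-bound companion of the flattening bound `s ≥ 2^n/(n+1)` of
`Theorems/RowPartitionRank.lean`.

HONEST FRAMING: a classical identity; nothing here bears on `VP ≠ VNP`, which is NOT proved.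

## References
* [Ryser1963] H. J. Ryser, *Combinatorial Mathematics*, Carus Monograph 14, MAA 1963, Ch. 2,
  Thm. 4.1 (the inclusion–exclusion formula for the permanent).
-/

-- layout Summits/ValiantsHypothesis/ValiantsHypothesis forces the duplicated namespace component
set_option linter.dupNamespace false

namespace Summit.ValiantsHypothesis.ValiantsHypothesis.Theorems.RyserFormula

open Finset MvPolynomial Literature.Computability.AlgebraicComplexity

noncomputable section

section Ring

variable {R : Type*} [CommRing R] {ι : Type*} [Fintype ι] [DecidableEq ι]

/-- The alternating sum over the supersets of a set `U`: `Σ_{S ⊇ U} (-1)^(n-|S|) = [U = univ]`.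
[cite: Ryser1963, Ch. 2 Thm. 4.1] -/
theorem sum_superset_neg_one_pow (U : Finset ι) :
    ∑ S ∈ (univ : Finset ι).powerset.filter (fun S => U ⊆ S), (-1 : R) ^ (Fintype.card ι - S.card) =
      if U = univ then 1 else 0 := by
  -- reindex by complements: `S ↦ Sᶜ`, supersets of `U` ↔ subsets of `Uᶜ`, `n - |S| = |Sᶜ|`
  have hre : ∑ S ∈ (univ : Finset ι).powerset.filter (fun S => U ⊆ S),
      (-1 : R) ^ (Fintype.card ι - S.card) = ∑ T ∈ (Uᶜ).powerset, (-1 : R) ^ T.card := by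
    refine sum_nbij' (fun S => Sᶜ) (fun T => Tᶜ) ?_ ?_ ?_ ?_ ?_
    · intro S hS
      rw [mem_filter] at hS
      exact mem_powerset.mpr (compl_subset_compl.mpr hS.2)
    · intro T hT
      rw [mem_powerset] at hT
      refine mem_filter.mpr ⟨mem_powerset.mpr (subset_univ _), ?_⟩
      have := compl_subset_compl.mpr hT
      rwa [compl_compl] at this
    · intro S _; exact compl_compl S
    · intro T _; exact compl_compl T
    · intro S _; rw [card_compl]
  rw [hre]
  have hz := (Finset.sum_powerset_neg_one_pow_card (x := Uᶜ))
  have hcast : (∑ T ∈ (Uᶜ).powerset, (-1 : R) ^ T.card) =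
      ((∑ T ∈ (Uᶜ).powerset, (-1 : ℤ) ^ T.card : ℤ) : R) := by push_cast; rfl
  rw [hcast, hz]
  by_cases hU : U = univ
  · simp [hU]
  · have : Uᶜ ≠ ∅ := fun h => hU ((compl_eq_empty_iff U).mp h)
    simp [hU, this]

/-- **Ryser's formula.** `per A = Σ_{S ⊆ ι} (-1)^(n - |S|) ∏_i Σ_{j ∈ S} A i j`.
[cite: Ryser1963, Ch. 2 Thm. 4.1] -/
theorem permanent_eq_ryser (A : Matrix ι ι R) :
    A.permanent = ∑ S ∈ (univ : Finset ι).powerset,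
      (-1 : R) ^ (Fintype.card ι - S.card) * ∏ i, ∑ j ∈ S, A i j := by
  -- expand the products: functions `f : ι → ι` with values in `S`
  have hexp : ∀ S : Finset ι, ∏ i, ∑ j ∈ S, A i j =
      ∑ f ∈ Fintype.piFinset (fun _ : ι => S), ∏ i, A i (f i) :=
    fun S => Finset.prod_univ_sum (fun _ : ι => S) (fun i j => A i j)
  simp_rw [hexp, mul_sum]
  -- swap the sums: `f` outside, supersets of `im f` inside
  rw [sum_comm' (s' := fun f : ι → ι => (univ : Finset ι).powerset.filter (fun S => univ.image f ⊆ S))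
    (t' := (univ : Finset (ι → ι)))
    (h := fun S f => by
      simp only [mem_powerset, subset_univ, true_and, Fintype.mem_piFinset, mem_univ, and_true,
        mem_filter, image_subset_iff, true_imp_iff])]
  simp_rw [← sum_mul, sum_superset_neg_one_pow, ite_mul, one_mul, zero_mul]
  rw [← sum_filter]
  -- the functions with `im f = univ` are the permutations
  rw [← Matrix.permanent_transpose, Matrix.permanent]
  refine sum_nbij (fun σ : Equiv.Perm ι => (σ : ι → ι)) ?_ ?_ ?_ ?_
  · intro σ _
    refine mem_filter.mpr ⟨mem_univ _, ?_⟩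
    exact eq_univ_of_forall fun j => mem_image.mpr ⟨σ.symm j, mem_univ _, σ.apply_symm_apply j⟩
  · intro σ _ τ _ h
    exact Equiv.ext (congrFun h)
  · intro f hf
    have hf' : univ.image f = univ := (mem_filter.mp hf).2
    have hsurj : Function.Surjective f := fun j => by
      have : j ∈ univ.image f := by rw [hf']; exact mem_univ j
      obtain ⟨i, -, hi⟩ := mem_image.mp this
      exact ⟨i, hi⟩
    have hbij : Function.Bijective f := Finite.surjective_iff_bijective.mp hsurj
    exact ⟨Equiv.ofBijective f hbij, by simp, rfl⟩
  · intro σ _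
    simp [Matrix.transpose_apply]

end Ring

/-! ### The generic permanent -/

section Generic

variable {R : Type*} [CommRing R]

/-- Ryser's formula for the generic permanent `per_n ∈ R[x_{ij}]`.
[cite: Ryser1963, Ch. 2 Thm. 4.1] -/
theorem perPoly_eq_ryser (n : ℕ) :
    perPoly (Fin n) R = ∑ S ∈ (univ : Finset (Fin n)).powerset,
      (-1 : MvPolynomial (Fin n × Fin n) R) ^ (n - S.card) * ∏ i, ∑ j ∈ S, X (i, j) := by
  unfold Literature.Computability.AlgebraicComplexity.perPoly
  rw [permanent_eq_ryser]
  simp [Matrix.mvPolynomialX_apply, Fintype.card_fin]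

/-- **`per_n` is a sum of `2^n` products of row-local linear forms** (Ryser's formula read as a
row-set-multilinear `ΣΠΣ` expression of top fan-in `2^n`; the sign `(-1)^(n-|S|)` is carried by the
factor of the row `0`). [cite: Ryser1963, Ch. 2 Thm. 4.1] -/
theorem exists_rowLocal_repr_perPoly (n : ℕ) :
    ∃ q : Fin (2 ^ n) → Fin n → MvPolynomial (Fin n × Fin n) R,
      (∀ t i, ∃ g : MvPolynomial (Fin n) R, q t i = rename (Prod.mk i) g) ∧
      perPoly (Fin n) R = ∑ t, ∏ i, q t i := by
  classical
  -- index the subsets of `Fin n` by `Fin (2^n)`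
  have hcard : Fintype.card (Finset (Fin n)) = 2 ^ n := by
    rw [Fintype.card_finset, Fintype.card_fin]
  let e : Finset (Fin n) ≃ Fin (2 ^ n) := Fintype.equivFinOfCardEq hcard
  -- the factors: `L_{S,i} = Σ_{j ∈ S} x_{i,j}`, the sign folded into the row `0`
  let sgn : Finset (Fin n) → MvPolynomial (Fin n × Fin n) R := fun S => (-1) ^ (n - S.card)
  let L : Finset (Fin n) → Fin n → MvPolynomial (Fin n × Fin n) R := fun S i => ∑ j ∈ S, X (i, j)
  let q : Fin (2 ^ n) → Fin n → MvPolynomial (Fin n × Fin n) R :=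
    fun t i => if (i : ℕ) = 0 then sgn (e.symm t) * L (e.symm t) i else L (e.symm t) i
  refine ⟨q, fun t i => ?_, ?_⟩
  · -- row-locality
    by_cases hi : (i : ℕ) = 0
    · refine ⟨(-1) ^ (n - (e.symm t).card) * ∑ j ∈ e.symm t, X j, ?_⟩
      simp [q, sgn, L, hi, map_sum, rename_X]
    · refine ⟨∑ j ∈ e.symm t, X j, ?_⟩
      simp [q, L, hi, map_sum, rename_X]
  · -- the sum is Ryser's, reindexed by `e`
    rw [perPoly_eq_ryser, Finset.powerset_univ,
      ← Fintype.sum_equiv e (fun S => ∏ i, q (e S) i) (fun t => ∏ i, q t i) (fun S => rfl)]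
    refine Finset.sum_congr rfl fun S _ => ?_
    simp only [q, Equiv.symm_apply_apply]
    rcases Nat.eq_zero_or_pos n with hn | hn
    · subst hn
      have hS : S = ∅ := eq_empty_of_isEmpty S
      subst hS
      simp
    · have h0 : (⟨0, hn⟩ : Fin n) ∈ (univ : Finset (Fin n)) := mem_univ _
      rw [← Finset.mul_prod_erase univ (fun i : Fin n => ∑ j ∈ S, (X (i, j) : MvPolynomial _ R)) h0,
        ← Finset.mul_prod_erase univ
          (fun i : Fin n => if (i : ℕ) = 0 then sgn S * L S i else L S i) h0]
      have hrest : ∏ i ∈ univ.erase (⟨0, hn⟩ : Fin n),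
          (if (i : ℕ) = 0 then sgn S * L S i else L S i) = ∏ i ∈ univ.erase (⟨0, hn⟩ : Fin n), L S i := by
        refine prod_congr rfl fun i hi => ?_
        have : (i : ℕ) ≠ 0 := fun h => (ne_of_mem_erase hi) (Fin.ext h)
        simp [this]
      rw [hrest]
      simp only [↓reduceIte, sgn, L]
      ring

end Generic

end

end Summit.ValiantsHypothesis.ValiantsHypothesis.Theorems.RyserFormula
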